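import Literature.Barriers.MatrixMultiplication.UnstableTensorBarrierMinimalBorderRank
import Literature.Computability.AlgebraicComplexity.QuantumFunctionalsDegenerationProofs
import Literature.Computability.AlgebraicComplexity.JelisiejewLandsbergPal2023MinimalBorderRank
import HarnessLib

/-!
# Square-zero matrices in adapted bases, and unstable restrictions bound `Q̃`

Solo programme `solo-MatrixMultiplication-informed` (gen 18), door D10 — infrastructure for
"a square-zero triple in the 111-algebra makes a concise tensor unstable".

* `asymptoticSubrank_lt_of_isUnstable_restrictsTo` — if an unstable `s ∈ ℂ^{n×n×n}` (`n ≥ 1`)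
  restricts to `t`, then `Q̃(t) < n` (Bläser–Lysikov §2.3 chain of the tree: separating weight,
  bounded separating weight, slice-rank bound).
* `exists_adapted_basis` — for `f ∈ End V` with `f² = 0` there is a basis indexed by
  `(Fin r ⊕ Fin n₁) ⊕ Fin r` (blocks `im f | ker f / im f | complement`) with `f (b (inr k)) = b (inl (inl k))`
  and `f = 0` on the `inl` block.
* coordinates: `dualMat`/`vecMat` of a basis of `K^ι`, `contractᵢ = actTensor`, transport of the
  three contractions under the change of coordinates `actTensor (dualMat bA) (dualMat bB) (dualMat bC)`,
  the conjugated matrix `dualMat b * P * vecMat b = toMatrix b b (toLin' P)`, its normal form `IsNF`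
  in an adapted basis, and the evaluation of the three contractions with a normal-form matrix.

References: [cite: BlaserLysikov2020, §2.3, Thm. 17]; [cite: JelisiejewLandsbergPal2023, Thm. 1.10].
-/

open scoped BigOperators Matrix
open Matrix

namespace Summit.MatrixMultiplication.MatrixMultiplication.Theorems

open Literature.Computability.AlgebraicComplexity Literature.Barriers.MatrixMultiplication

namespace SquareZeroNormalForm

/-! ## Unstable restrictions bound the asymptotic subrank -/

section Unstable

variable {ι κ μ α β γ : Type} [Fintype ι] [Fintype κ] [Fintype μ] [Fintype α] [Fintype β]
  [Fintype γ] [DecidableEq α] [DecidableEq β] [DecidableEq γ]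

/-- If an unstable `s ∈ ℂ^{α×β×γ}` of cubic format `n ≥ 1` restricts to `t`, then `Q̃(t) < n`.
[cite: BlaserLysikov2020, §2.3 and Thm. 17 (proof)] -/
theorem asymptoticSubrank_lt_of_isUnstable_restrictsTo {n : ℕ} (hn : 0 < n)
    (hα : Fintype.card α = n) (hβ : Fintype.card β = n) (hγ : Fintype.card γ = n)
    (t : ι → κ → μ → ℂ) {s : α → β → γ → ℂ} (hu : IsUnstable s) (hst : TensorRestrictsTo s t) :
    asymptoticSubrank ℂ t < n := by
  classical
  obtain ⟨s', hs's, -, x, y, z, hx, hy, hz, hsep⟩ := hu.exists_sepWeight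
  set S : Finset (α × β × γ) := Finset.univ.filter fun p => s' p.1 p.2.1 p.2.2 ≠ 0 with hS
  obtain ⟨x', y', z', hx', hy', hz', hsep', hbx, hby, hbz⟩ :=
    exists_bounded_sepWeight hn hα hβ hγ S x y z hx hy hz
      (fun p hp => hsep p.1 p.2.1 p.2.2 (by simpa [hS] using hp))
  set c : ℝ := 2 * n * Real.sqrt 3 ^ (3 * n) with hcdef
  have hcpos : 0 < c := by positivity
  have hQ := asymptoticSubrank_le_of_sepWeight t s' (hs's.trans hst) x' y' z' hx' hy' hz' hcpos
    hcpos hcpos hbx hby hbz (fun a b c' h => hsep' (a, b, c') (by simpa [hS] using h)) hα.le hβ.le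
    hγ.le
  have hnpos : (0 : ℝ) < n := by exact_mod_cast hn
  have hexp : Real.exp (-(1 / (2 * (c + c + c) ^ 2))) < 1 :=
    Real.exp_lt_one_iff.2 (by rw [neg_lt_zero]; positivity)
  calc asymptoticSubrank ℂ t ≤ (n : ℝ) * Real.exp (-(1 / (2 * (c + c + c) ^ 2))) := hQ
    _ < n * 1 := mul_lt_mul_of_pos_left hexp hnpos
    _ = n := mul_one _

end Unstable

/-! ## Adapted bases for a square-zero endomorphism -/

section Adapted

variable {K V : Type*} [Field K] [AddCommGroup V] [Module K V] [FiniteDimensional K V]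

/-- **Adapted basis.** If `f² = 0` there is a basis `b` of `V` indexed by `(Fin r ⊕ Fin n₁) ⊕ Fin r`
with `f (b (inr k)) = b (inl (inl k))` and `f (b (inl x)) = 0` (the blocks are a basis `f c₂` of
`f(W₂)`, a basis of a complement of `f(W₂)` in `ker f`, and a basis `c₂` of a complement `W₂` of
`ker f`). [folklore] -/
theorem exists_adapted_basis (f : V →ₗ[K] V) (hf : ∀ v, f (f v) = 0) :
    ∃ (r n₁ : ℕ) (b : Module.Basis ((Fin r ⊕ Fin n₁) ⊕ Fin r) K V),
      (∀ k, f (b (Sum.inr k)) = b (Sum.inl (Sum.inl k))) ∧ ∀ x, f (b (Sum.inl x)) = 0 := by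
  set p : Submodule K V := LinearMap.ker f with hp
  obtain ⟨W₂, hW₂⟩ := p.exists_isCompl
  set g : W₂ →ₗ[K] V := f ∘ₗ W₂.subtype with hg
  have hginj : Function.Injective g := by
    intro u v huv
    have hmem : (u : V) - v ∈ p := by
      rw [hp, LinearMap.mem_ker, map_sub, sub_eq_zero]; exact huv
    have h0 := (Submodule.disjoint_def.1 hW₂.disjoint) _ hmem (W₂.sub_mem u.2 v.2)
    exact Subtype.ext (sub_eq_zero.1 h0)
  set q : Submodule K V := LinearMap.range g with hq
  have hqp : q ≤ p := by
    rintro _ ⟨u, rfl⟩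
    rw [hp, LinearMap.mem_ker]; exact hf u
  set c₂ := Module.finBasis K W₂
  set bq : Module.Basis (Fin (Module.finrank K W₂)) K q := c₂.map (LinearEquiv.ofInjective g hginj)
  have hbq : ∀ k, (bq k : V) = f (c₂ k) := fun k => by
    simp only [bq, Module.Basis.map_apply]; rfl
  set qp : Submodule K p := Submodule.comap p.subtype q with hqpdef
  obtain ⟨W₁, hW₁⟩ := qp.exists_isCompl
  set c₁ := Module.finBasis K W₁
  set bqp : Module.Basis (Fin (Module.finrank K W₂)) K qp :=
    bq.map (Submodule.comapSubtypeEquivOfLe hqp).symm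
  have hbqp : ∀ k, ((bqp k : p) : V) = f (c₂ k) := fun k => by
    simp only [bqp, Module.Basis.map_apply]; exact hbq k
  set bp : Module.Basis (Fin (Module.finrank K W₂) ⊕ Fin (Module.finrank K W₁)) K p :=
    (bqp.prod c₁).map (Submodule.prodEquivOfIsCompl qp W₁ hW₁)
  have hbp : ∀ k, (bp (Sum.inl k) : V) = f (c₂ k) := fun k => by
    simp [bp, Submodule.coe_prodEquivOfIsCompl', Module.Basis.prod_apply, hbqp]
  set b : Module.Basis ((Fin (Module.finrank K W₂) ⊕ Fin (Module.finrank K W₁)) ⊕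
      Fin (Module.finrank K W₂)) K V := (bp.prod c₂).map (Submodule.prodEquivOfIsCompl p W₂ hW₂)
  have hb_inl : ∀ x, b (Sum.inl x) = (bp x : V) := fun x => by
    simp [b, Submodule.coe_prodEquivOfIsCompl', Module.Basis.prod_apply]
  have hb_inr : ∀ k, b (Sum.inr k) = (c₂ k : V) := fun k => by
    simp [b, Submodule.coe_prodEquivOfIsCompl', Module.Basis.prod_apply]
  refine ⟨_, _, b, fun k => ?_, fun x => ?_⟩
  · rw [hb_inr, hb_inl, hbp]
  · rw [hb_inl]
    exact LinearMap.mem_ker.1 (bp x).2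

end Adapted

/-! ## Coordinates: change of bases on the three legs -/

section Coordinates

variable {K : Type*} [Field K] {ι κ μ : Type*} [Fintype ι] [Fintype κ] [Fintype μ]
  [DecidableEq ι] [DecidableEq κ] [DecidableEq μ] {α β γ : Type*} [Fintype α] [Fintype β]
  [Fintype γ] [DecidableEq α] [DecidableEq β] [DecidableEq γ]

/-- The coordinate matrix of a basis of `K^ι`: `(dualMat b) i a = (b.repr e_a) i`. [folklore] -/
noncomputable def dualMat (b : Module.Basis α K (ι → K)) : Matrix α ι K :=
  b.toMatrix (Pi.basisFun K ι)

/-- The matrix whose columns are the basis vectors: `(vecMat b) a i = b i a`. [folklore] -/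
noncomputable def vecMat (b : Module.Basis α K (ι → K)) : Matrix ι α K :=
  (Pi.basisFun K ι).toMatrix b

omit [Fintype κ] [Fintype μ] [DecidableEq κ] [DecidableEq μ] [DecidableEq α] in
/-- `vecMat b * dualMat b = 1`. [folklore] -/
theorem vecMat_mul_dualMat (b : Module.Basis α K (ι → K)) : vecMat b * dualMat b = 1 :=
  Module.Basis.toMatrix_mul_toMatrix_flip _ _

omit [Fintype κ] [Fintype μ] [DecidableEq κ] [DecidableEq μ] [DecidableEq ι] [Fintype α] in
/-- `dualMat b * vecMat b = 1`. [folklore] -/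
theorem dualMat_mul_vecMat (b : Module.Basis α K (ι → K)) : dualMat b * vecMat b = 1 :=
  Module.Basis.toMatrix_mul_toMatrix_flip _ _

omit [Fintype κ] [Fintype μ] [DecidableEq κ] [DecidableEq μ] in
/-- The conjugated matrix is the matrix of `toLin' P` in the basis `b`. [folklore] -/
theorem dualMat_mul_mul_vecMat (b : Module.Basis α K (ι → K)) (P : Matrix ι ι K) :
    dualMat b * P * vecMat b = LinearMap.toMatrix b b (Matrix.toLin' P) := by
  rw [dualMat, vecMat, ← basis_toMatrix_mul_linearMap_toMatrix_mul_basis_toMatrix b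
    (Pi.basisFun K ι) b (Pi.basisFun K ι), LinearMap.toMatrix_eq_toMatrix',
    LinearMap.toMatrix'_toLin']

omit [Fintype α] [Fintype β] [Fintype γ] [DecidableEq ι] in
/-- `P ·₁ t = (P ⊗ 1 ⊗ 1)·t`. [folklore] -/
theorem contract₁_eq_actTensor (P : Matrix ι ι K) (t : ι → κ → μ → K) :
    contract₁ P t = actTensor P (1 : Matrix κ κ K) (1 : Matrix μ μ K) t := by
  funext a b c
  simp [contract₁_apply, actTensor_apply, Matrix.one_apply, Finset.sum_ite_eq, ite_mul,
    mul_ite]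

omit [Fintype α] [Fintype β] [Fintype γ] [DecidableEq κ] in
/-- `Q ·₂ t = (1 ⊗ Q ⊗ 1)·t`. [folklore] -/
theorem contract₂_eq_actTensor (Q : Matrix κ κ K) (t : ι → κ → μ → K) :
    contract₂ Q t = actTensor (1 : Matrix ι ι K) Q (1 : Matrix μ μ K) t := by
  funext a b c
  simp [contract₂_apply, actTensor_apply, Matrix.one_apply, Finset.sum_ite_eq, ite_mul,
    mul_ite]

omit [Fintype α] [Fintype β] [Fintype γ] [DecidableEq μ] in
/-- `R ·₃ t = (1 ⊗ 1 ⊗ R)·t`. [folklore] -/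
theorem contract₃_eq_actTensor (Rm : Matrix μ μ K) (t : ι → κ → μ → K) :
    contract₃ Rm t = actTensor (1 : Matrix ι ι K) (1 : Matrix κ κ K) Rm t := by
  funext a b c
  simp [contract₃_apply, actTensor_apply, Matrix.one_apply, Finset.sum_ite_eq, ite_mul,
    mul_ite]

omit [DecidableEq α] in
/-- Transport of the first contraction under a change of coordinates:
`(D_A P E_A) ·₁ (D·t) = D·(P ·₁ t)`. [folklore] -/
theorem contract₁_coords (bA : Module.Basis α K (ι → K)) (bB : Module.Basis β K (κ → K))
    (bC : Module.Basis γ K (μ → K)) (P : Matrix ι ι K) (t : ι → κ → μ → K) :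
    contract₁ (dualMat bA * P * vecMat bA) (actTensor (dualMat bA) (dualMat bB) (dualMat bC) t) =
      actTensor (dualMat bA) (dualMat bB) (dualMat bC) (contract₁ P t) := by
  rw [contract₁_eq_actTensor, contract₁_eq_actTensor, actTensor_actTensor, actTensor_actTensor,
    Matrix.mul_assoc, vecMat_mul_dualMat, Matrix.mul_one, Matrix.one_mul, Matrix.one_mul,
    Matrix.mul_one, Matrix.mul_one]

omit [DecidableEq β] in
/-- Transport of the second contraction under a change of coordinates. [folklore] -/
theorem contract₂_coords (bA : Module.Basis α K (ι → K)) (bB : Module.Basis β K (κ → K))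
    (bC : Module.Basis γ K (μ → K)) (Q : Matrix κ κ K) (t : ι → κ → μ → K) :
    contract₂ (dualMat bB * Q * vecMat bB) (actTensor (dualMat bA) (dualMat bB) (dualMat bC) t) =
      actTensor (dualMat bA) (dualMat bB) (dualMat bC) (contract₂ Q t) := by
  rw [contract₂_eq_actTensor, contract₂_eq_actTensor, actTensor_actTensor, actTensor_actTensor,
    Matrix.mul_assoc, vecMat_mul_dualMat, Matrix.mul_one, Matrix.one_mul, Matrix.one_mul,
    Matrix.mul_one, Matrix.mul_one]

omit [DecidableEq γ] in
/-- Transport of the third contraction under a change of coordinates. [folklore] -/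
theorem contract₃_coords (bA : Module.Basis α K (ι → K)) (bB : Module.Basis β K (κ → K))
    (bC : Module.Basis γ K (μ → K)) (Rm : Matrix μ μ K) (t : ι → κ → μ → K) :
    contract₃ (dualMat bC * Rm * vecMat bC) (actTensor (dualMat bA) (dualMat bB) (dualMat bC) t) =
      actTensor (dualMat bA) (dualMat bB) (dualMat bC) (contract₃ Rm t) := by
  rw [contract₃_eq_actTensor, contract₃_eq_actTensor, actTensor_actTensor, actTensor_actTensor,
    Matrix.mul_assoc, vecMat_mul_dualMat, Matrix.mul_one, Matrix.one_mul, Matrix.one_mul,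
    Matrix.mul_one, Matrix.mul_one]

omit [DecidableEq α] [DecidableEq β] [DecidableEq γ] in
/-- The original tensor is a restriction of its coordinate tensor. [folklore] -/
theorem restrictsTo_of_coords (bA : Module.Basis α K (ι → K)) (bB : Module.Basis β K (κ → K))
    (bC : Module.Basis γ K (μ → K)) (t : ι → κ → μ → K) :
    TensorRestrictsTo (actTensor (dualMat bA) (dualMat bB) (dualMat bC) t) t := by
  have h := tensorRestrictsTo_actTensor (vecMat bA) (vecMat bB) (vecMat bC)
    (actTensor (dualMat bA) (dualMat bB) (dualMat bC) t)
  rwa [actTensor_actTensor, vecMat_mul_dualMat, vecMat_mul_dualMat, vecMat_mul_dualMat,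
    actTensor_one] at h

end Coordinates

/-! ## Normal form of a square-zero matrix in an adapted basis -/

section NormalForm

variable {K : Type*} [Field K]

/-- The adapted index type `(Fin r ⊕ Fin n₁) ⊕ Fin r` (blocks `im | ker/im | complement`). [folklore] -/
abbrev Blk (r n₁ : ℕ) : Type := (Fin r ⊕ Fin n₁) ⊕ Fin r

/-- Normal form: the only non-zero entries are `N (inl (inl k)) (inr k) = 1`. [folklore] -/
def IsNF {r n₁ : ℕ} (N : Matrix (Blk r n₁) (Blk r n₁) K) : Prop :=
  (∀ i k, N i (Sum.inr k) = if i = Sum.inl (Sum.inl k) then 1 else 0) ∧ ∀ i x, N i (Sum.inl x) = 0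

variable {ι : Type*} [Fintype ι] [DecidableEq ι]

/-- In an adapted basis of `toLin' P`, the conjugated matrix is in normal form. [folklore] -/
theorem isNF_of_adapted {r n₁ : ℕ} (b : Module.Basis (Blk r n₁) K (ι → K)) (P : Matrix ι ι K)
    (h₁ : ∀ k, Matrix.toLin' P (b (Sum.inr k)) = b (Sum.inl (Sum.inl k)))
    (h₂ : ∀ x, Matrix.toLin' P (b (Sum.inl x)) = 0) : IsNF (dualMat b * P * vecMat b) := by
  rw [dualMat_mul_mul_vecMat]
  refine ⟨fun i k => ?_, fun i x => ?_⟩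
  · rw [LinearMap.toMatrix_apply, h₁, b.repr_self, Finsupp.single_apply]
    by_cases h : i = Sum.inl (Sum.inl k)
    · rw [if_pos h, if_pos h.symm]
    · rw [if_neg h, if_neg (Ne.symm h)]
  · rw [LinearMap.toMatrix_apply, h₂, map_zero, Finsupp.zero_apply]

omit [DecidableEq ι] in
/-- A matrix in normal form with `r = 0` is zero, so `P = 0`. [folklore] -/
theorem eq_zero_of_isNF_zero {n₁ : ℕ} [DecidableEq ι] (b : Module.Basis (Blk 0 n₁) K (ι → K))
    (P : Matrix ι ι K) (h : IsNF (dualMat b * P * vecMat b)) : P = 0 := by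
  have hN : dualMat b * P * vecMat b = 0 := by
    ext i j
    rcases j with x | k
    · exact h.2 i x
    · exact k.elim0
  have : vecMat b * (dualMat b * P * vecMat b) * dualMat b = P := by
    rw [Matrix.mul_assoc, Matrix.mul_assoc, vecMat_mul_dualMat, Matrix.mul_one, ← Matrix.mul_assoc,
      vecMat_mul_dualMat, Matrix.one_mul]
  rw [← this, hN, Matrix.mul_zero, Matrix.zero_mul]

variable {κ' μ' : Type*}

omit [Fintype ι] [DecidableEq ι] in
/-- First contraction with a normal-form matrix. [folklore] -/
theorem contract₁_isNF {r n₁ : ℕ} {N : Matrix (Blk r n₁) (Blk r n₁) K} (hN : IsNF N)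
    (u : Blk r n₁ → κ' → μ' → K) (i : Blk r n₁) (j : κ') (l : μ') :
    contract₁ N u i j l = ∑ k : Fin r, if i = Sum.inl (Sum.inl k) then u (Sum.inr k) j l else 0 := by
  simp only [contract₁_apply, Fintype.sum_sum_type, hN.2, zero_mul, Finset.sum_const_zero, zero_add,
    hN.1, ite_mul, one_mul]

omit [Fintype ι] [DecidableEq ι] in
/-- Second contraction with a normal-form matrix. [folklore] -/
theorem contract₂_isNF {r n₁ : ℕ} {N : Matrix (Blk r n₁) (Blk r n₁) K} (hN : IsNF N)
    (u : κ' → Blk r n₁ → μ' → K) (i : κ') (j : Blk r n₁) (l : μ') :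
    contract₂ N u i j l = ∑ k : Fin r, if j = Sum.inl (Sum.inl k) then u i (Sum.inr k) l else 0 := by
  simp only [contract₂_apply, Fintype.sum_sum_type, hN.2, zero_mul, Finset.sum_const_zero, zero_add,
    hN.1, ite_mul, one_mul]

omit [Fintype ι] [DecidableEq ι] in
/-- Third contraction with a normal-form matrix. [folklore] -/
theorem contract₃_isNF {r n₁ : ℕ} {N : Matrix (Blk r n₁) (Blk r n₁) K} (hN : IsNF N)
    (u : κ' → μ' → Blk r n₁ → K) (i : κ') (j : μ') (l : Blk r n₁) :
    contract₃ N u i j l = ∑ k : Fin r, if l = Sum.inl (Sum.inl k) then u i j (Sum.inr k) else 0 := by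
  simp only [contract₃_apply, Fintype.sum_sum_type, hN.2, zero_mul, Finset.sum_const_zero, zero_add,
    hN.1, ite_mul, one_mul]

end NormalForm

end SquareZeroNormalForm

end Summit.MatrixMultiplication.MatrixMultiplication.Theorems
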